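import Summits.Schanuel.Schanuel.Theorems.RootDecomp1KSuperellipticSiegel01

/-!
# RootDecomp1KSuperellipticSiegel — lens 1, generation 63, NODE 24 «SUPERELLIPTIC SIEGEL ON THE K-LINE — the lacunary dominant-far sector» (the superelliptic Siegel–LeVeque theorem y^m = f(x), m ≥ 3, f with two simple roots, over any number field — PROVED from the tree's unit equation via the cyclotomic–Kummer tower and Siegel's identity; the engine on DOMINANT LACUNARY pairs c_k(Y)·x^k + c₀(Y), k ≥ 3 ⇒ SiegelClause / LevelFinite / ThinFibreAt ∀ m₀ / BddLevelEmpty, intrinsically the class DomSuper P; the genus-six family T j := x³ − (Y⁷ + (4j+2)Y − (4j+2)) decided hypothesis-free ∀ j ∈ ℤ; the territory T_territory incl. 2-adic liveness by size at m₀ = 2; CLAIM L2927, PRICE L2930, K-R55) — continuation (RootDecomp1KSuperellipticSiegel02): §L main theorem: finite_integer_pow_eq_of_unitEquation (U-binder verbatim), finite_integer_pow_eq (unconditional), finite_integer_pow_eq_of_separable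

(lens-1 g63 NODE 24 «SUPERELLIPTIC SIEGEL ON THE K-LINE — the LACUNARY DOMINANT-FAR SECTOR» L2940/L2941: HOME kernel K = HOME/decomp-schanuel-lens-1/g63/lean/SuperellipticSiegel.lean sha256 f78e5b9a…, 1410 l, ONE namespace `Summit.Schanuel.Schanuel.Theorems.RootDecomp1KSuperellipticSiegel`, imports the tree port …RootDecomp1KHyperellipticSiegel05 ONLY (node 23's part 01 carries the PROVED Literature modules SiegelCubicReduction / UnitEquationFinite / SIntegersFiniteExtension; no …Proofs umbrella, no fact file); no private, no instance, no set_option, no notation, no sorry, no decide; CLAIM L2927, census LIVENESS-v29 (rows T 0 / T 17 tabled on request, OF RECORD L2931 with the critic's territory certificate; keys domSuper / ladder / superell / galtop), crit g12 PRICE L2930 (PAYABLE THEOREM ×1 EX ANTE for (L)+(E)+(F)+(T) jointly under RULE K-R54 (iii) — the superelliptic grade, the LAST credit on the integral-points lane; CHECKLIST K-g63 (1)–(11); RULE K-R55 PRE-ANNOUNCED), writer g33 NOTE 8 L2928 (pre-check 16/16), critic VERDICT: CLEARED — THEOREM ×1 for (L)+(E)+(F)+(T) JOINTLY, ONE credit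 (RULE K-R54 (iii), the superelliptic grade — the LAST credit on the integral-points lane), VERDICT L2943 (crit-1 g12, 2026-09-01T23:12Z): CHECKLIST K-g63 (1)–(11) met item by item on the critic's own farm runs (K rc 0 · 0 errors · 0 sorries; Probe rc 0 with 253 `#print axioms` guards ⊆ the standard triple; Ctrl0 rc 0; Ctrl rc 1 = exactly the 53 planted errors; L_standalone rc 0 ⇒ §L is K-line-independent modulo node 23's Literature-only part 01); TALLY lens-1 ×21 + THEOREM ×23; RULE K-R55 FIXED ((i) toolkit ∪= superelliptic integral-point Siegel — THE INTEGRAL-POINTS LANE IS CLOSED; (ii) open territory at m₀ = 2 := K-R54 (ii) territory not reached by (i): NON-DOMINANT (standing witness W4) and DOMINANT-FAR NON-LACUNARY (standing witness X3); (iii) payable clause; (iv) unconditional part ∪= the node-24 tree names after the port); PORT GO L2944 exactly as census STAGING NOTE 15 L2942 (six parts; the two docstring-preserving boundary moves approved; no privatisation). Port by census-1 gen 24 per NODE-g63.md §(11) as `RootDecomp1KSuperellipticSiegel01–06` (`--supports stmt-Schanuel-33364`; the item stays OPEN; no census credit): 01 = §L floors (section Local: the m-divisibility lemma `natCast_dvd_log_map_sub_of_pow_eq_mul_prod`,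 Siegel's factors / identity / ratio `geomSum_mul_sub_eq` / `map_sub_mul_eq_one` / `siegel_identity_pow` / `eq_of_ratio`; the cyclotomic + Kummer tower `exists_numberField_forall_mem_selmerGroup_isPow` / `exists_numberField_forall_isPow_of_dvd`; bad places `exists_finite_places`); 02 = §L main theorem `finite_integer_pow_eq_of_unitEquation` (U-binder verbatim as the tree's cubic case) + `finite_integer_pow_eq` (unconditional by `finite_unitEquation`) + `finite_integer_pow_eq_of_separable`; 03 = §E the engine on dominant LACUNARY pairs of x-degree k ≥ 3 (the `_lac` chain over node 23's `den_dvd_of_dyadic`, `def DomSuper`, `domSuper_xPolyP_iff` / `domSuper_twoTermP_iff`, the doors `siegelClause_of_domSuper` / `levelFinite_of_domSuper` / `thinFibreAt_of_domSuper` / `bddLevelEmpty_of_domSuper`, disjointness `not_domHyper_of_domSuper` / `not_domSuper_*`) (section Engine); 04 = §F the family `A j`, `tC`, `T j` (`T_eq_twoTermP`), `isEisensteinAt_A` ⇒ `domSuper_T` ⇒ `levelFinite_T` / `thinFibreAt_T` / `siegelClause_T` / … (section Family); 05 = §T part 1 (coefficient read-backs, shape refusals, the deciders' negations, GaussAt 3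 and the ladder at 3, the anchor (1, 1), the odd-prime sieves refused, real liveness) (section Territory, to be continued); 06 = §T part 2 ((T-2) `den_pow_seven_le_T` / `den_pow_lt_T` / `not_thin_ineq_two_T`, `thinFibreAt_two_iff_levelFinite_T`, `T_territory`, `T'` with `T'_zero` / `T'_one` / `T'_territory`) (section Territory re-opened with K's own open-lines). Literature / node-23 twins are CITED by name, never restated. Text = K VERBATIM (every declaration documented by the lens; statements and proofs unchanged; K's module docstring kept in part 01 below this provenance block).)
-/

noncomputable section

namespace Summit.Schanuel.Schanuel.Theorems.RootDecomp1KSuperellipticSiegel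

open Polynomial IsDedekindDomain NumberField
open scoped Classical WithZero
open Literature.NumberTheory.DiophantineGeometry (finite_unitEquation exists_finite_forall_mem_integer_algebraMap
  valuation_algebraMap_eq_one_of_mem_integer_inv valuation_eq_one_of_mul_eq_one)
open IsDedekindDomain.HeightOneSpectrum (setOf_valuation_ne_one_finite setOf_one_lt_valuation_finite)
open Summit.Schanuel.Schanuel.Theorems.RootDecomp1KHyperellipticSiegel (setOf_ne_and_valuation_sub_ne_one_finite)

universe u

/-- **THE SUPERELLIPTIC SIEGEL–LEVEQUE THEOREM, FROM THE UNIT EQUATION** (Siegel 1926; LeVeque 1964; Shorey–Tijdeman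
Ch. 6 Thm 6.1 / Ch. 8 Thm 8.1; Bombieri–Gubler Remark 5.3.8).  Assume `U`: for every number field `F` (in the
universe of `L`) and every finite set `T` of finite places of `F`, only finitely many `T`-units `u` admit a `T`-unit
`v` with `u + v = 1` (binder VERBATIM as in the tree's `finite_integer_sq_eq_of_unitEquation`).  Then for a number
field `L`, a finite set `T` of finite places, `m ≥ 3`, and `g, h ∈ L[X]` with `g` SEPARABLE of degree `≥ 2` and
COPRIME to `h` — so that `f = g·h` has at least two simple roots — the set of `T`-integral `x ∈ L` with `f(x)` an
`m`-th power in `L` is FINITE: `y^m = f(x)` has only finitely many solutions `x ∈ R_T`, `y ∈ L`.  Proof: tower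
`L ⊆ F₁ ⊆ F₂` (`F₁` = splitting field of `f·Φ_m`, `F₂` = the Kummer field of `F₁(T₁, m)`), the local lemma at the two
simple roots, the three unit factors `w₁ − ζ^i w₂`, Siegel's identity, and `x = Ψ(U)`. -/
theorem finite_integer_pow_eq_of_unitEquation (L : Type u) [Field L] [NumberField L]
    (U : ∀ (F : Type u) [Field F] [NumberField F] (T : Set (HeightOneSpectrum (𝓞 F))),
      T.Finite → {u : Fˣ | u ∈ T.unit F ∧ ∃ v : Fˣ, v ∈ T.unit F ∧ (u : F) + v = 1}.Finite)
    (T : Set (HeightOneSpectrum (𝓞 L))) (hT : T.Finite) {m : ℕ} (hm : 3 ≤ m) (g h : L[X])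
    (hsep : g.Separable) (hdeg : 2 ≤ g.natDegree) (hcop : IsCoprime g h) :
    {x : L | x ∈ T.integer L ∧ ∃ y : L, y ^ m = (g * h).eval x}.Finite := by
  have hm0 : m ≠ 0 := by omega
  have hmpos : 0 < m := by omega
  haveI : NeZero m := ⟨hm0⟩
  -- §0 `g`, `h`, `f = g·h` are non-zero
  have hg0 : g ≠ 0 := by rintro rfl; simp at hdeg
  have hh0 : h ≠ 0 := by
    rintro rfl
    have hu : IsUnit g := isCoprime_zero_right.mp hcop
    have h0 := natDegree_eq_zero_of_isUnit hu
    omega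
  have hf0 : g * h ≠ 0 := mul_ne_zero hg0 hh0
  -- the splitting field `F₁` of `f · Φ_m`: all roots of `f` and a primitive `m`-th root of unity `ζ`
  let F₁ : Type u := (g * h * cyclotomic m L).SplittingField
  haveI : NumberField F₁ := NumberField.of_module_finite L F₁
  set ι₁ : L →+* F₁ := algebraMap L F₁ with hι₁
  have hq0 : g * h * cyclotomic m L ≠ 0 := mul_ne_zero hf0 (cyclotomic_ne_zero m L)
  have hsplitq : ((g * h * cyclotomic m L).map ι₁).Splits := SplittingField.splits _
  set f₁ : F₁[X] := (g * h).map ι₁ with hf₁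
  set g₁ : F₁[X] := g.map ι₁ with hg₁
  set h₁ : F₁[X] := h.map ι₁ with hh₁
  have hf₁0 : f₁ ≠ 0 := Polynomial.map_ne_zero hf0
  have hg₁0 : g₁ ≠ 0 := Polynomial.map_ne_zero hg0
  have hf₁gh : f₁ = g₁ * h₁ := by rw [hf₁, hg₁, hh₁, Polynomial.map_mul]
  have hsplit : f₁.Splits :=
    hsplitq.of_dvd (Polynomial.map_ne_zero hq0) (by rw [Polynomial.map_mul]; exact dvd_mul_right _ _)
  have hsplitg : g₁.Splits := hsplit.of_dvd hf₁0 (by rw [hf₁gh]; exact dvd_mul_right _ _)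
  have hsplitc' : ((cyclotomic m L).map ι₁).Splits :=
    hsplitq.of_dvd (Polynomial.map_ne_zero hq0) (by rw [Polynomial.map_mul]; exact dvd_mul_left _ _)
  have hsplitc : (cyclotomic m F₁).Splits := by rwa [map_cyclotomic] at hsplitc'
  obtain ⟨ζ, hζroot⟩ : ∃ z : F₁, (cyclotomic m F₁).eval z = 0 :=
    hsplitc.exists_eval_eq_zero (by
      rw [degree_cyclotomic]
      exact_mod_cast (Nat.totient_pos.mpr hmpos).ne')
  have hζ : IsPrimitiveRoot ζ m := isRoot_cyclotomic_iff.mp hζroot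
  have hζm : ζ ^ m = 1 := hζ.pow_eq_one
  have hζ1 : ζ ≠ 1 := hζ.ne_one (by omega)
  have hζ2 : ζ ^ 2 ≠ 1 := hζ.pow_ne_one_of_pos_of_lt two_ne_zero (by omega)
  have h1ζ : (1 : F₁) + ζ ≠ 0 := fun h0 => hζ2 (by
    rw [show ζ = -1 by linear_combination h0]
    ring)
  have hζ0 : ζ ≠ 0 := fun h0 => by
    rw [h0, zero_pow hm0] at hζm
    exact zero_ne_one hζm
  -- the roots `s` of `f₁`, its leading coefficient, and two roots `e₁ ≠ e₂` of `g₁` (simple roots of `f₁`)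
  set s : Multiset F₁ := f₁.roots with hs
  set lc : F₁ := f₁.leadingCoeff with hlc_def
  have hlc : lc ≠ 0 := leadingCoeff_ne_zero.mpr hf₁0
  have heval : ∀ x : F₁, f₁.eval x = lc * (s.map (x - ·)).prod := hsplit.eval_eq_prod_roots
  have hndg : g₁.roots.Nodup := nodup_roots hsep.map
  have hcardg : Multiset.card g₁.roots = g.natDegree := by
    rw [← hsplitg.natDegree_eq_card_roots, hg₁, natDegree_map]
  obtain ⟨e₁, he₁g⟩ : ∃ e, e ∈ g₁.roots := Multiset.card_pos_iff_exists_mem.mp (by omega)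
  have hc1 : Multiset.card (g₁.roots.erase e₁) = g.natDegree - 1 := by
    rw [Multiset.card_erase_of_mem he₁g, hcardg]; rfl
  obtain ⟨e₂, he₂g'⟩ : ∃ e, e ∈ (g₁.roots).erase e₁ := Multiset.card_pos_iff_exists_mem.mp (by
    rw [hc1]; omega)
  obtain ⟨h21, he₂g⟩ := (hndg.mem_erase_iff).mp he₂g'
  have hgs : g₁.roots ≤ s := roots.le_of_dvd hf₁0 (by rw [hf₁gh]; exact dvd_mul_right _ _)
  have he₁ : e₁ ∈ s := Multiset.mem_of_le hgs he₁g
  have he₂ : e₂ ∈ s := Multiset.mem_of_le hgs he₂g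
  obtain ⟨a, b, hab⟩ := hcop
  have hh₁e : ∀ e ∈ g₁.roots, h₁.eval e ≠ 0 := fun e he h0 => by
    have hge : g₁.eval e = 0 := (mem_roots hg₁0).mp he
    have h1 := congrArg (fun q : L[X] => (q.map ι₁).eval e) hab
    simp only [Polynomial.map_add, Polynomial.map_mul, Polynomial.map_one, eval_add, eval_mul, eval_one,
      ← hg₁, ← hh₁, hge, h0, mul_zero, add_zero] at h1
    exact zero_ne_one h1
  have hcount : ∀ e ∈ g₁.roots, s.count e = 1 := fun e he => by
    rw [hs, count_roots, hf₁gh, rootMultiplicity_mul (hf₁gh ▸ hf₁0), ← count_roots,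
      Multiset.count_eq_one_of_mem hndg he, rootMultiplicity_eq_zero (hh₁e e he), add_zero]
  have hne_of_mem_erase : ∀ e ∈ g₁.roots, ∀ e' ∈ s.erase e, e ≠ e' := fun e he e' he' hee' => by
    subst hee'
    have h1 := Multiset.count_erase_self e s
    have h2 : 0 < Multiset.count e (s.erase e) := Multiset.count_pos.mpr he'
    rw [hcount e he] at h1
    omega
  -- §1 the enlarged finite set of places `T₁` of `F₁` (`exists_finite_places`)
  obtain ⟨TF, hTF, hint⟩ := exists_finite_forall_mem_integer_algebraMap L F₁ hT
  obtain ⟨T₁, hT₁, hTF₁, hlc₁, hint₁, hunit₁, h1ζ₁⟩ := exists_finite_places F₁ hTF hlc s h1ζ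
  -- §2 the Kummer field `F₂ = F₁(ᵐ√F₁(T₁,m))`, a finite `T₂`, the unit equation in `F₂`, the map `Ψ`
  obtain ⟨F₂, _, _, _, hpow⟩ := exists_numberField_forall_isPow_of_dvd F₁ hT₁ hmpos
  obtain ⟨T₂, hT₂, hint₂⟩ := exists_finite_forall_mem_integer_algebraMap F₁ F₂ hT₁
  set ι₂ : F₁ →+* F₂ := algebraMap F₁ F₂ with hι₂
  set Sol : Set F₂ˣ := {u : F₂ˣ | u ∈ T₂.unit F₂ ∧ ∃ v : F₂ˣ, v ∈ T₂.unit F₂ ∧ (u : F₂) + v = 1}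
    with hSol_def
  have hSol : Sol.Finite := U F₂ T₂ hT₂
  set ζ' : F₂ := ι₂ ζ with hζ'
  set e₁' : F₂ := ι₂ e₁ with he₁'
  set e₂' : F₂ := ι₂ e₂ with he₂'
  set Ψ : F₂ˣ → F₂ := fun u =>
    (e₁' - ((1 - (u : F₂) * (1 + ζ') / ζ' * ζ') / (1 - (u : F₂) * (1 + ζ') / ζ')) ^ m * e₂') /
      (1 - ((1 - (u : F₂) * (1 + ζ') / ζ' * ζ') / (1 - (u : F₂) * (1 + ζ') / ζ')) ^ m) with hΨ
  have h12' : e₁' ≠ e₂' := fun h0 => h21 (ι₂.injective h0).symm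
  have hζ'm : ζ' ^ m = 1 := by rw [hζ', ← map_pow, hζm, map_one]
  have hζ'1 : ζ' ≠ 1 := fun h0 => hζ1 (ι₂.injective (by rw [map_one]; exact h0))
  have hζ'0 : ζ' ≠ 0 := (map_ne_zero ι₂).mpr hζ0
  have h1ζ'eq : (1 : F₂) + ζ' = ι₂ (1 + ζ) := by rw [map_add, map_one]
  have h1ζ' : (1 : F₂) + ζ' ≠ 0 := by rw [h1ζ'eq]; exact (map_ne_zero ι₂).mpr h1ζ
  have hζ'im : ∀ i : ℕ, (ζ' ^ i) ^ m = 1 := fun i => by rw [← pow_mul, mul_comm, pow_mul, hζ'm, one_pow]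
  have hζ'w : ∀ w : HeightOneSpectrum (𝓞 F₂), w ∉ T₂ → w.valuation F₂ ζ' = 1 := fun w _ =>
    map_eq_one_of_pow_eq_one (w.valuation F₂) hm0 hζ'm
  have h1ζ'w : ∀ w : HeightOneSpectrum (𝓞 F₂), w ∉ T₂ → w.valuation F₂ (1 + ζ') = 1 := fun w hw => by
    rw [h1ζ'eq]
    exact valuation_algebraMap_eq_one_of_mem_integer_inv hint₂ h1ζ (fun v hv => (h1ζ₁ v hv).le)
      (fun v hv => by rw [map_inv₀, h1ζ₁ v hv, inv_one]) hw
  have h21w : ∀ w : HeightOneSpectrum (𝓞 F₂), w ∉ T₂ → w.valuation F₂ (e₂' - e₁') = 1 := fun w hw => by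
    rw [he₂', he₁', ← map_sub]
    exact valuation_algebraMap_eq_one_of_mem_integer_inv hint₂ (sub_ne_zero.mpr h21)
      (fun v hv => (hunit₁ v hv e₂ he₂ e₁ he₁ h21).le)
      (fun v hv => by rw [map_inv₀, hunit₁ v hv e₂ he₂ e₁ he₁ h21, inv_one]) hw
  have he₁w : ∀ w : HeightOneSpectrum (𝓞 F₂), w ∉ T₂ → w.valuation F₂ e₁' ≤ 1 := fun w hw =>
    hint₂ e₁ (fun v hv => hint₁ v hv e₁ he₁) w hw
  have he₂w : ∀ w : HeightOneSpectrum (𝓞 F₂), w ∉ T₂ → w.valuation F₂ e₂' ≤ 1 := fun w hw =>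
    hint₂ e₂ (fun v hv => hint₁ v hv e₂ he₂) w hw
  -- §3 every solution maps into the finite set `Ψ(Sol) ∪ ι₂(roots)`
  refine Set.Finite.of_finite_image (f := fun x : L => ι₂ (ι₁ x))
    (((hSol.image Ψ).union (s.toFinset.finite_toSet.image ι₂)).subset ?_) (ι₂.injective.comp ι₁.injective).injOn
  rintro _ ⟨x, ⟨hx, y, hy⟩, rfl⟩
  set x₁ : F₁ := ι₁ x with hx₁
  set y₁ : F₁ := ι₁ y with hy₁
  have hy₁m : y₁ ^ m = lc * (s.map (x₁ - ·)).prod := by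
    rw [← heval, hy₁, hx₁, ← map_pow, hy, hf₁, eval_map, eval₂_at_apply]
  by_cases hroot : x₁ ∈ s
  · exact Or.inr ⟨x₁, Multiset.mem_toFinset.mpr hroot, rfl⟩
  refine Or.inl ?_
  have hxe : ∀ e ∈ s, x₁ - e ≠ 0 := fun e he h0 => hroot (by rwa [← sub_eq_zero.mp h0] at he)
  have hx₁int : x₁ ∈ T₁.integer F₁ := fun v hv => hint x hx v (hTF₁ v hv)
  -- the local lemma at the simple roots: `m ∣ ord_v(x₁ − e)` outside `T₁` for every root `e` of `g₁`
  have hdvd : ∀ e ∈ g₁.roots, ∀ v : HeightOneSpectrum (𝓞 F₁), v ∉ T₁ →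
      (m : ℤ) ∣ WithZero.log (v.valuation F₁ (x₁ - e)) := fun e he v hv =>
    natCast_dvd_log_map_sub_of_pow_eq_mul_prod (v.valuation F₁) hy₁m (hlc₁ v hv) (hx₁int v hv)
      (hint₁ v hv e (Multiset.mem_of_le hgs he)) (Multiset.mem_of_le hgs he) fun e' he' =>
        hunit₁ v hv e (Multiset.mem_of_le hgs he) e' (Multiset.mem_of_mem_erase he')
          (hne_of_mem_erase e he e' he')
  -- Kummer: `x₁ − e₁ = w₁^m`, `x₁ − e₂ = w₂^m` in `F₂`
  obtain ⟨w₁, hw₁0, hw₁⟩ := hpow (x₁ - e₁) (hxe e₁ he₁) (hdvd e₁ he₁g)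
  obtain ⟨w₂, hw₂0, hw₂⟩ := hpow (x₁ - e₂) (hxe e₂ he₂) (hdvd e₂ he₂g)
  rw [map_sub] at hw₁ hw₂
  set x' : F₂ := ι₂ x₁ with hx'
  have hx₂' : x' ≠ e₂' := fun h0 => hxe e₂ he₂ (sub_eq_zero.mpr (ι₂.injective h0))
  have hxw : ∀ w : HeightOneSpectrum (𝓞 F₂), w ∉ T₂ → w.valuation F₂ x' ≤ 1 := fun w hw =>
    hint₂ x₁ hx₁int w hw
  -- the three Siegel factors `uᵢ = w₁ − ζ'^i·w₂` are non-zero `T₂`-units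
  have hunits : ∀ w : HeightOneSpectrum (𝓞 F₂), w ∉ T₂ → ∀ i : ℕ, w.valuation F₂ (w₁ - ζ' ^ i * w₂) = 1 :=
    fun w hw i => map_sub_mul_eq_one (w.valuation F₂) hm0 hw₁ hw₂ (hζ'im i) (hxw w hw) (he₁w w hw) (he₂w w hw)
      (h21w w hw)
  have hu : ∀ i : ℕ, w₁ - ζ' ^ i * w₂ ≠ 0 := fun i h0 => by
    have hid := geomSum_mul_sub_eq hw₁ hw₂ (hζ'im i)
    rw [h0, mul_zero] at hid
    exact h12' (sub_eq_zero.mp hid.symm).symm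
  have hu₁ : w₁ - ζ' * w₂ ≠ 0 := by simpa using hu 1
  -- Siegel's identity `(1 + ζ')u₁ = ζ'u₀ + u₂` as a solution `U + V = 1` of the unit equation
  have hden : (1 + ζ') * (w₁ - ζ' ^ 1 * w₂) ≠ 0 := mul_ne_zero h1ζ' (hu 1)
  have hU0 : ζ' * (w₁ - ζ' ^ 0 * w₂) / ((1 + ζ') * (w₁ - ζ' ^ 1 * w₂)) ≠ 0 :=
    div_ne_zero (mul_ne_zero hζ'0 (hu 0)) hden
  have hV0 : (w₁ - ζ' ^ 2 * w₂) / ((1 + ζ') * (w₁ - ζ' ^ 1 * w₂)) ≠ 0 := div_ne_zero (hu 2) hden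
  have hUSol : Units.mk0 _ hU0 ∈ Sol := by
    refine ⟨fun w hw => ?_, Units.mk0 _ hV0, fun w hw => ?_, ?_⟩
    · rw [Units.val_mk0, map_div₀, map_mul, map_mul, hζ'w w hw, hunits w hw 0, h1ζ'w w hw, hunits w hw 1]
      simp
    · rw [Units.val_mk0, map_div₀, map_mul, hunits w hw 2, h1ζ'w w hw, hunits w hw 1]
      simp
    · rw [Units.val_mk0, Units.val_mk0, ← add_div, div_eq_one_iff_eq hden]
      ring
  refine ⟨Units.mk0 _ hU0, hUSol, ?_⟩
  -- `Ψ(U) = x'`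
  have hκ : (Units.mk0 _ hU0 : F₂) * (1 + ζ') / ζ' = (w₁ - w₂) / (w₁ - ζ' * w₂) := by
    rw [Units.val_mk0, div_mul_eq_mul_div, div_div, div_eq_div_iff (mul_ne_zero hden hζ'0) hu₁]
    ring
  obtain ⟨-, hxΨ⟩ := eq_of_ratio hw₁ hw₂ h12' hζ'1 hx₂' hu₁ hκ
  rw [hΨ]
  exact hxΨ.symm

/-- **THE SUPERELLIPTIC SIEGEL–LEVEQUE THEOREM — UNCONDITIONAL** (Shorey–Tijdeman Thm 6.1 / 8.1 shape): for a number
field `L`, a finite set `T` of finite places, `m ≥ 3` and `f = g·h ∈ L[X]` with `g` separable of degree `≥ 2` and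
coprime to `h`, only finitely many `T`-integers `x` make `f(x)` an `m`-th power in `L`.  The unit equation is the
tree's PROVED `finite_unitEquation` (Bombieri–Gubler 5.2.1). -/
theorem finite_integer_pow_eq (L : Type u) [Field L] [NumberField L] (T : Set (HeightOneSpectrum (𝓞 L)))
    (hT : T.Finite) {m : ℕ} (hm : 3 ≤ m) (g h : L[X]) (hsep : g.Separable) (hdeg : 2 ≤ g.natDegree)
    (hcop : IsCoprime g h) : {x : L | x ∈ T.integer L ∧ ∃ y : L, y ^ m = (g * h).eval x}.Finite :=
  finite_integer_pow_eq_of_unitEquation L (fun F _ _ T' hT' => finite_unitEquation F T' hT') T hT hm g h hsep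
    hdeg hcop

/-- the separable case `h = 1`: `y^m = f(x)`, `f` separable of degree `≥ 2`, `m ≥ 3` — finitely many `x ∈ R_T`
(LeVeque's theorem for a separable `f`). -/
theorem finite_integer_pow_eq_of_separable (L : Type u) [Field L] [NumberField L]
    (T : Set (HeightOneSpectrum (𝓞 L))) (hT : T.Finite) {m : ℕ} (hm : 3 ≤ m) (f : L[X]) (hsep : f.Separable)
    (hdeg : 2 ≤ f.natDegree) : {x : L | x ∈ T.integer L ∧ ∃ y : L, y ^ m = f.eval x}.Finite := by
  simpa only [mul_one] using finite_integer_pow_eq L T hT hm f 1 hsep hdeg isCoprime_one_right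

end Summit.Schanuel.Schanuel.Theorems.RootDecomp1KSuperellipticSiegel

end
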